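import Summits.BirchSwinnertonDyer.Rank1Residual.SecondDescent.BSDpFromSecondDescentNonemptyX4
import Summits.BirchSwinnertonDyer.Rank1Residual.X11b.ChaPairsMinimality
import HarnessLib

/-!
# B-1 second-3-descent `NONEMPTY × 2` RECORDS on X4 (additive at 3), analytic rank 0 — batch 01: the record SHAPE for a literal model + the minimality certificate of the one window target `19215t1` (cell `b2b-bsdres`, CLASS-CLOSURE instrument seat cc-eng-4, GEN 6)

HONEST FRAMING (run/shared/lean/b2b/bsd-rank1-residual/, verbatim in every file): the goal of the
cell is to DELETE the COMBINATION-SHAPED residual classes of the Birch–Swinnerton-Dyer formula for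
ALL analytic-rank `≤ 1` elliptic curves over `ℚ` — "full BSD formula for every rank `≤ 1` curve in
class `C`" assembled STRICTLY from published theorems — so that the rank-`≤ 1` remainder becomes
exactly the CONSTRUCTION-SHAPED classes, which are TYPED (missing-input `Prop`s), NOT attempted.
This is not "finishing BSD". Class X4 stays CONSTRUCTION-SHAPED; everything here is PER PAIR;
per-curve second-descent outputs are INSTRUMENTATION (class-closure
E4) / EVIDENCE under census-lead's tier label; no lane verdict is changed; no named fact is added;
nothing is booked by this unit. NO B-1 run on `19215t1` exists yet (front bundle
`class-closure/eng-4/b1/production-staged-g6/bundles/front-B1W-19215t1-t3/` is STAGED, not run;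
cc-lead ⟦gen26⟧ (6)(e): it rides inside DAILY item (2) only on an x10b / N4–N6 want line, under H):
this file therefore holds NO record for it — only the two kernel pieces a record will need.

Theorems only. **What this file proves.**
* `X4RankZero.bsdp_three_of_ainvs_of_kato_of_surj9_of_casselsTate_of_two_nonempty` — the
  consumer `X4RankZero.bsdp_three_of_kato_of_surj9_of_casselsTate_of_two_nonempty` (p294123) for a
  LITERAL integer model `⟨a₁,…,a₆⟩`: `IsElliptic` from `discOf ≠ 0` (`decide`) and
  `IsGloballyMinimal` supplied as a hypothesis (discharged per curve by
  `X11b.isGloballyMinimal_of_krausCriterion_bounded₂`, three `decide`s); all arithmetic inputs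
  (`r_an = 0`, `ClassX4`, `ord₃ j ≥ 0`, `ρ̄_{E,9}` onto, `3 ∤ ∏ c_ℓ`, a parametrisation datum with
  `3 ∤ c_D`, `#Ш[3] = 9`, the two `NONEMPTY` witnesses, `ord₃ #Ш_an ≤ 4`) as binders;
* `isGloballyMinimal_s19215t1` — Cremona's model `[0,0,1,-10107597,-12660392115]` of `19215t1`
  (`N = 19215 = 3²·5·7·61`, type I₀* at `3`, `r_an = 0`, `#Ш_an = 81`, `∏ c_ℓ = 2`; the one
  sha-2-census RESISTANT T-full3 window row with `ord₃ #Ш_an = 4`) is globally minimal, by Kraus'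
  bounded criterion in the kernel; and `isElliptic_s19215t1`.
References: K. Kato, Astérisque 295 (2004) Thm. 14.5 (3) [Kato2004Asterisque]; B. Creutz, Math.
Comp. 83 (2014) [Creutz2014]; A. Kraus, Manuscripta Math. 65 (1989) Prop. 1–2 [Kraus1989];
J. H. Silverman, *AEC* VII.1, X.4.14 [SilvermanAEC2009]; R. L. Miller 2011 §1 [Miller2011LMS];
J. E. Cremona's tables [Cremona2006].
-/

set_option autoImplicit false

noncomputable section

open scoped Classical

open WeierstrassCurve Literature.NumberTheory.EllipticCurves
  Literature.NumberTheory.EllipticCurves.ModularForms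
  Literature.NumberTheory.EllipticCurves.Rank1Residual
  Literature.NumberTheory.EllipticCurves.Rank1Residual.Typed
  Literature.NumberTheory.EllipticCurves.Rank1Residual.X11RankOneCertificates
  Summit.BirchSwinnertonDyer.Rank1Residual.X11b

namespace Summit.BirchSwinnertonDyer.Rank1Residual.SecondDescent

/-! ### §1. The record shape for a literal model -/

/-- **X4 `NONEMPTY × 2` reading for a literal model, `p = 3`, analytic rank `0`, `ρ̄_{E,9}` onto.**
For integers `a₁,…,a₆` with `discOf ≠ 0` and a globally minimal model (`hmin`, per curve by Kraus'
bounded criterion): Kato's upper half (`hKato`) + GZK + modularity + the Cassels–Tate pairing fact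
+ [X4 at `3`, `r_an = 0`, `ord₃ j ≥ 0`, surj(9), `3 ∤ ∏ c_ℓ`, `3 ∤ c_D`] + `#Ш(E)[3] = 9` + two
`3`-torsion classes spanning `Ш[3]` that are BOTH third multiples in `Ш` (the two `NONEMPTY`
second-descent certificates) + `ord₃ #Ш_an ≤ 4` ⟹ `BSD(E,3)`. Per pair; class X4 unchanged;
nothing booked. [cite: Kato2004Asterisque, Thm. 14.5 (3) (p. 236)] [cite: SilvermanAEC2009, Thm. X.4.14]
[cite: Creutz2014, §1] [cite: Miller2011LMS, §1 and Def. 1.1] -/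
theorem X4RankZero.bsdp_three_of_ainvs_of_kato_of_surj9_of_casselsTate_of_two_nonempty
    (hKato : Kato2004.rankZero_padicValNat_sha_le_of_additive_potGood_of_imageContainsSL2)
    (hGZK : rank_eq_analyticRank_of_analyticRank_le_one) (hmod : hasEntireLFunction_rat)
    (hCT : exists_casselsTate_pairing (K := ℚ))
    (a1 a2 a3 a4 a6 : ℤ) (hΔ : discOf [a1, a2, a3, a4, a6] ≠ 0)
    (hmin : (⟨a1, a2, a3, a4, a6⟩ : WeierstrassCurve ℚ).IsGloballyMinimal)
    (hr : (⟨a1, a2, a3, a4, a6⟩ : WeierstrassCurve ℚ).analyticRank = 0)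
    (hX : ClassX4 (⟨a1, a2, a3, a4, a6⟩ : WeierstrassCurve ℚ) 3)
    (hpot : haveI := isElliptic_of_discOf_ne_zero a1 a2 a3 a4 a6 hΔ
      0 ≤ padicValRat 3 (⟨a1, a2, a3, a4, a6⟩ : WeierstrassCurve ℚ).j)
    (h9 : (⟨a1, a2, a3, a4, a6⟩ : WeierstrassCurve ℚ).HasSurjectiveModNGaloisRep 9)
    (htam : ¬ 3 ∣ (⟨a1, a2, a3, a4, a6⟩ : WeierstrassCurve ℚ).tamagawaProduct)
    {N : ℕ} [NeZero N] (D : ModularParametrizationData (⟨a1, a2, a3, a4, a6⟩ : WeierstrassCurve ℚ) N)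
    (hc : ¬ (3 : ℤ) ∣ D.maninConstant)
    (hcard : Nat.card (AddSubgroup.torsionBy (⟨a1, a2, a3, a4, a6⟩ : WeierstrassCurve ℚ).sha (3 : ℤ))
      = 9)
    {c₁ c₂ d₁ d₂ : (⟨a1, a2, a3, a4, a6⟩ : WeierstrassCurve ℚ).sha} (h1 : 3 • c₁ = 0)
    (h2 : 3 • c₂ = 0) (hc₁ : c₁ ≠ 0) (hind : c₂ ∉ AddSubgroup.zmultiples c₁) (hd₁ : 3 • d₁ = c₁)
    (hd₂ : 3 • d₂ = c₂)
    {q : ℚ} (hq : shaAn (⟨a1, a2, a3, a4, a6⟩ : WeierstrassCurve ℚ) = (q : ℂ))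
    (hv : padicValRat 3 q ≤ 4) : BSDp (⟨a1, a2, a3, a4, a6⟩ : WeierstrassCurve ℚ) 3 := by
  haveI := isElliptic_of_discOf_ne_zero a1 a2 a3 a4 a6 hΔ
  haveI := hmin
  exact X4RankZero.bsdp_three_of_kato_of_surj9_of_casselsTate_of_two_nonempty _ hKato hGZK hmod hCT
    hr hX hpot h9 htam D hc hcard h1 h2 hc₁ hind hd₁ hd₂ hq hv

/-! ### §2. The one window target: `19215t1` — kernel pieces only (no B-1 run yet) -/

/-- `19215t1`'s Cremona model: `Δ ≠ 0` (kernel). [cite: Cremona2006, Table 1 (Cremona label 19215t1)] -/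
theorem isElliptic_s19215t1 :
    (⟨0, 0, 1, -10107597, -12660392115⟩ : WeierstrassCurve ℚ).IsElliptic :=
  isElliptic_of_discOf_ne_zero 0 0 1 (-10107597) (-12660392115) (by decide +kernel)

/-- `19215t1`'s Cremona model `[0,0,1,-10107597,-12660392115]` is globally minimal (Kraus' bounded
criterion, kernel). [cite: Kraus1989, Prop. 1 and Prop. 2] [cite: SilvermanAEC2009, VII.1 Remark 1.1]
[cite: Cremona2006, Table 1 (Cremona label 19215t1)] -/
theorem isGloballyMinimal_s19215t1 :
    (⟨0, 0, 1, -10107597, -12660392115⟩ : WeierstrassCurve ℚ).IsGloballyMinimal :=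
  isGloballyMinimal_of_krausCriterion_bounded₂ 0 0 1 (-10107597) (-12660392115) (by decide +kernel)
    (by decide +kernel) (by decide +kernel)

end Summit.BirchSwinnertonDyer.Rank1Residual.SecondDescent

end
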